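import Mathlib
import Literature.Analysis.Calculus.IteratedFDerivParametricIntegral
import HarnessLib

/-!
# The restriction of a `Cⁿ` scalar field to a line: the `HasDerivAt` chain of its iterated derivatives and the bound
# `|dⁱ/dsⁱ e(k + s·w)| ≤ ‖w‖ⁱ · sup ‖Dⁱe‖`

Topic `Literature/Analysis/Calculus`; companion of `IteratedDifferenceDerivBound` (differences of `g` along `w` are differences of `s ↦ g(k + s•w)`)
and `ThirdOrderChainRule` (composition with a `HasDerivAt` chain).  Lattice differences of a symbol composed with a BAND `e : E → ℝ` along a grid
direction `w` (Benfatto–Giuliani–Mastropietro 2006, (2.36aa); §3 (3.2)–(3.8) for a framed band telescoped over its pieces) read the band through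
the line `s ↦ e(k + s•w)`: this file turns `ContDiff ℝ n e` plus sup bounds of `Dⁱe` into the `HasDerivAt` chain `u, u₁, u₂, …` of the line
restriction (`u_i = iteratedDeriv i`) with `|u_i(s)| ≤ ‖w‖ⁱ·C_i`.

* `hasDerivAt_iteratedDeriv_of_contDiff` — `HasDerivAt (iteratedDeriv k φ) (iteratedDeriv (k+1) φ s) s` for `k < n`, `φ : ℝ → F` of class `Cⁿ`;
* `contDiff_comp_line` — `s ↦ e(k + s • w)` is `Cⁿ` when `e` is;
* **`norm_iteratedDeriv_comp_line_le_of_bound`** — `‖iteratedDeriv i (s ↦ e(k + s•w)) s‖ ≤ ‖w‖ⁱ · C` when `‖Dⁱe‖ ≤ C` everywhere (`i ≤ n`).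

Everything is proved; no definitions; no named facts. [folklore]

## Sources

G. Benfatto, A. Giuliani, V. Mastropietro, Ann. Henri Poincaré 7 (2006) 809–898, (2.36aa) (`BenfattoGiulianiMastropietro2006`).  Routine calculus.
-/

noncomputable section

namespace Literature.Analysis.Calculus

open Set
open scoped ContDiff

variable {E : Type*} [NormedAddCommGroup E] [NormedSpace ℝ E] {F : Type*} [NormedAddCommGroup F] [NormedSpace ℝ F]

/-- **The iterated derivatives of a `Cⁿ` function of one variable form a `HasDerivAt` chain**: for `k < n`,
`HasDerivAt (iteratedDeriv k φ) (iteratedDeriv (k+1) φ s) s`. [cite: BenfattoGiulianiMastropietro2006, (2.36aa)] -/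
theorem hasDerivAt_iteratedDeriv_of_contDiff {φ : ℝ → F} {n : ℕ} (hφ : ContDiff ℝ n φ) {k : ℕ} (hk : k < n) (s : ℝ) :
    HasDerivAt (iteratedDeriv k φ) (iteratedDeriv (k + 1) φ s) s := by
  have hd : Differentiable ℝ (iteratedDeriv k φ) := hφ.differentiable_iteratedDeriv k (by exact_mod_cast hk)
  rw [iteratedDeriv_succ]
  exact (hd s).hasDerivAt

/-- The line map `s ↦ s • w` as a continuous linear map `ℝ →L[ℝ] E`, and its norm `‖w‖`. [cite: BenfattoGiulianiMastropietro2006, (2.36aa)] -/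
theorem norm_smulRight_one (w : E) : ‖(ContinuousLinearMap.smulRight (1 : ℝ →L[ℝ] ℝ) w)‖ = ‖w‖ := by
  rw [ContinuousLinearMap.norm_smulRight_apply, norm_one, one_mul]

/-- **The restriction of a `Cⁿ` field to a line is `Cⁿ`.** [cite: BenfattoGiulianiMastropietro2006, (2.36aa)] -/
theorem contDiff_comp_line {e : E → F} {n : ℕ∞} (he : ContDiff ℝ n e) (k w : E) : ContDiff ℝ n fun s : ℝ => e (k + s • w) :=
  he.comp ((contDiff_const).add (contDiff_id.smul contDiff_const))

/-- **Derivatives along a line are bounded by `‖w‖ⁱ` times the field's derivatives**: if `e : E → F` is `Cⁿ` with `‖Dⁱe(x)‖ ≤ C` for all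
`x` (`i ≤ n`), then `‖iteratedDeriv i (s ↦ e(k + s•w)) s‖ ≤ ‖w‖ⁱ · C`. [cite: BenfattoGiulianiMastropietro2006, (2.36aa)] -/
theorem norm_iteratedDeriv_comp_line_le_of_bound {e : E → F} {n : ℕ} (he : ContDiff ℝ n e) (k w : E) {i : ℕ} (hi : i ≤ n) {C : ℝ}
    (hC : ∀ x, ‖iteratedFDeriv ℝ i e x‖ ≤ C) (s : ℝ) : ‖iteratedDeriv i (fun s : ℝ => e (k + s • w)) s‖ ≤ ‖w‖ ^ i * C := by
  set L : ℝ →L[ℝ] E := ContinuousLinearMap.smulRight (1 : ℝ →L[ℝ] ℝ) w with hL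
  have hfun : (fun s : ℝ => e (k + s • w)) = fun s : ℝ => e (L s + k) := by
    funext s; simp [hL, add_comm]
  have hC0 : 0 ≤ C := (norm_nonneg _).trans (hC k)
  rw [← norm_iteratedFDeriv_eq_norm_iteratedDeriv, hfun]
  have h := norm_iteratedFDeriv_comp_affine_le (N := (n : ℕ∞ω)) (by exact_mod_cast he) L k (n := i) (by exact_mod_cast hi) s
  refine h.trans ?_
  rw [hL, norm_smulRight_one, mul_comm]
  exact mul_le_mul_of_nonneg_left (hC _) (by positivity)

end Literature.Analysis.Calculus

end
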